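import Summits.CriticalPhenomena.CardyFormulaZ2.Theorems.CardyIKTransportIKLinearTransportQuenchedLongCross
import Summits.CriticalPhenomena.CardyFormulaZ2.Theorems.CardyIKTransportIKLinearTransportFarRSWOfInputs

/-!
# Stub `stub_ringOfHarris` (line `pinned-diagram-exchange` v29, crux `CardyIKTransport.IKLinearTransport`,
# stmt-CriticalPhenomena-5076)

Support file (`--supports stmt-CriticalPhenomena-5076`): the FRAME assembly
`RingOfHarris : RingBlocking → LRAll → ApproxHarrisFam → RingAll` of skeleton v29
(`…IKLinearTransportQuenchedAssemblyDefs`).  From the deterministic blocking statement (black long-way crossings of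
the four `n`-wide strips around a `w × h` box confine every white path meeting the box to its `n`-neighbourhood),
the left–right clause at every aspect bound (`LRAll`), the landed bottom–top clause at every aspect bound
(`FarRSWAllAspects.ikFarRSW_tbCross_all`) and approximate Harris for families of box events (`ApproxHarrisFam`),
the ring event `ringEvent a b w h n` of every `w × h` box with `n ≤ w ≤ k n`, `n ≤ h ≤ k n`, `n ≥ 1` has
`ν_S`-probability `≥ c_k > 0`, uniformly in the pattern `S` and the position.  Theorems only (no new vocabulary).

Proof, for a fixed aspect bound `k`.
* THE FRAME AS ONE FAMILY (§1): the four strips of `frameEvent a b w h n` — the `(w + 2n) × n` top and bottom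
  strips (left–right) and the `n × (h + 2n)` left and right strips (bottom–top) — are ONE family
  `Fin 4 → BoxSpec`; every box of it is at least `n × n` (`frame_family`), and the intersection of its four box
  events is carried into `obs S ⁻¹' ringEvent a b w h n` by `RingBlocking` (`iInter_frame_subset`).  With
  `c = min c_L c_T`, `c_L` the constant of `LRAll (k+2)` and `c_T` that of `ikFarRSW_tbCross_all (k+2)` (the strips
  have aspect `≤ k + 2` at scale `n`), every box of the family has annealed probability `≥ c`, so the product of
  the four is `≥ c^4` (`LongCross.pow_le_prod`).
* LARGE SCALES `n ≥ n₀` (§2), `n₀ = n₀(4, c^4/2)` the scale of `ApproxHarrisFam`: `μ(⋂) ≥ ∏ − c^4/2 ≥ c^4/2`,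
  and `μIK (obs S ⁻¹' E) ≤ (νmix S) E` for EVERY set `E` (`real_preimage_le_nuMix`, `Measure.le_map_apply` — no
  measurability of the ring event is needed).
* SMALL SCALES `1 ≤ n < n₀` (§2): the landed finite-energy floor `farRSW_small k n₀` (force the box black by
  single-cell flips; a white path meets no cell of an all-black box, so the ring event holds vacuously), read at
  the trivial far event `E = univ`.
So `c_k = min (c^4/2) c_fe` works.
-/

noncomputable section

namespace Summit.CriticalPhenomena.CardyFormulaZ2.Theorems.IKLinearTransport.PinnedDiagramExchange.QuenchedAssembly

open scoped Classical BigOperators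
open MeasureTheory Set
open Summit.CriticalPhenomena.CardyFormulaZ2.Theorems.IKLinearTransport.PinnedDiagramExchange
open Summit.CriticalPhenomena.CardyFormulaZ2.Cruxes.IKMixedBoxCrossing.QuenchedChainFKG
  (ApproxHarrisFam BoxSpec boxEvent boxProb boxProb_lr boxProb_tb)
open Summit.CriticalPhenomena.CardyFormulaZ2.Cruxes.IKMixedBoxCrossing.QuenchedChainFKG.Harris7
  (boxEvent_lr boxEvent_tb)
open Summit.CriticalPhenomena.CardyFormulaZ2.Cruxes.IKMixedBoxCrossing.PairedMirrorExploration (pLR pTB)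
open Summit.CriticalPhenomena.CardyFormulaZ2.Cruxes.IKMixedBoxCrossing.DefectClosureExploration
  (nuMix_real_lrCross nuMix_real_tbCross)
open Summit.CriticalPhenomena.CardyFormulaZ2.Theorems.IKLinearTransport.PinnedDiagramExchange.FarRSWAllAspects
  (ikFarRSW_tbCross_all)
open Literature.Probability.Percolation Literature.Probability.LatticeModels

namespace RingHarris

/-! ## §1 The frame as one family of four box events -/

/-- SIZES AND FLOORS OF THE FRAME FAMILY: every strip of the frame of the `w × h` box at `(a, b)` at distance `n`
(top, bottom: `(w + 2n) × n`, left–right; left, right: `n × (h + 2n)`, bottom–top) is at least `n × n`, and its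
annealed probability is at least any common floor `c` of the four strip-crossing probabilities. [folklore] -/
theorem frame_family (S : Set ℤ) (a b : ℤ) (w h n : ℕ) {c : ℝ}
    (hT : c ≤ pLR S (a - n) (b + h) (w + 2 * n) n) (hB : c ≤ pLR S (a - n) (b - n) (w + 2 * n) n)
    (hL : c ≤ pTB S (a - n) (b - n) n (h + 2 * n)) (hR : c ≤ pTB S (a + w) (b - n) n (h + 2 * n)) :
    ∀ i, (n ≤ ((![⟨true, a - n, b + h, w + 2 * n, n⟩, ⟨true, a - n, b - n, w + 2 * n, n⟩,
        ⟨false, a - n, b - n, n, h + 2 * n⟩, ⟨false, a + w, b - n, n, h + 2 * n⟩] : Fin 4 → BoxSpec) i).w ∧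
      n ≤ ((![⟨true, a - n, b + h, w + 2 * n, n⟩, ⟨true, a - n, b - n, w + 2 * n, n⟩,
        ⟨false, a - n, b - n, n, h + 2 * n⟩, ⟨false, a + w, b - n, n, h + 2 * n⟩] : Fin 4 → BoxSpec) i).h) ∧
      c ≤ boxProb S ((![⟨true, a - n, b + h, w + 2 * n, n⟩, ⟨true, a - n, b - n, w + 2 * n, n⟩,
        ⟨false, a - n, b - n, n, h + 2 * n⟩, ⟨false, a + w, b - n, n, h + 2 * n⟩] : Fin 4 → BoxSpec) i) := by
  simp only [Fin.forall_fin_succ, IsEmpty.forall_iff, and_true, Matrix.cons_val_zero, Matrix.cons_val_succ,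
    boxProb_lr, boxProb_tb]
  exact ⟨⟨⟨by omega, le_rfl⟩, hT⟩, ⟨⟨by omega, le_rfl⟩, hB⟩, ⟨⟨le_rfl, by omega⟩, hL⟩, ⟨⟨le_rfl, by omega⟩, hR⟩⟩

/-- THE FRAME FAMILY IS BLOCKING: under `RingBlocking`, the intersection of the four strip-crossing events of the
frame family (that is, `obs S ⁻¹' frameEvent a b w h n`) lies in `obs S ⁻¹' ringEvent a b w h n` (`n ≥ 1`). [folklore] -/
theorem iInter_frame_subset (hBl : RingBlocking) (S : Set ℤ) (a b : ℤ) (w h n : ℕ) (hn : 1 ≤ n) :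
    (⋂ i, boxEvent S ((![⟨true, a - n, b + h, w + 2 * n, n⟩, ⟨true, a - n, b - n, w + 2 * n, n⟩,
        ⟨false, a - n, b - n, n, h + 2 * n⟩, ⟨false, a + w, b - n, n, h + 2 * n⟩] : Fin 4 → BoxSpec) i)) ⊆
      obs S ⁻¹' ringEvent a b w h n := by
  intro ω hω
  have h' := Set.mem_iInter.1 hω
  simp only [Fin.forall_fin_succ, IsEmpty.forall_iff, and_true, Matrix.cons_val_zero, Matrix.cons_val_succ,
    boxEvent_lr, boxEvent_tb, Set.mem_preimage] at h'
  exact hBl (obs S ω) a b w h n hn ⟨⟨h'.1, h'.2.1⟩, ⟨h'.2.2.1, h'.2.2.2⟩⟩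

/-! ## §2 Transfer to the observable law -/

/-- TRANSFER WITHOUT MEASURABILITY: for every set `E` of observables, `μIK (obs S ⁻¹' E) ≤ (νmix S) E`
(`νmix S = μIK.map (obs S)` and `Measure.le_map_apply`). [folklore] -/
theorem real_preimage_le_nuMix (S : Set ℤ) (E : Set Obs) : μIK.real (obs S ⁻¹' E) ≤ (νmix S).real E := by
  haveI : IsProbabilityMeasure (νmix S) := isProbabilityMeasure_nuMix S
  rw [measureReal_def, measureReal_def]
  exact ENNReal.toReal_mono (measure_ne_top _ _)
    (Measure.le_map_apply (CouplingToLimits.measurable_obs S).aemeasurable E)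

end RingHarris

open RingHarris LongCross in
/-- **STUB `stub_ringOfHarris`** (registered signature): `RingBlocking → LRAll → ApproxHarrisFam → RingAll` —
black rings in the `n`-neighbourhood of every `w × h` box with `n ≤ w ≤ k n`, `n ≤ h ≤ k n`, for every column
pattern and every aspect bound: for `n ≥ n₀` the frame of four strip crossings (the two horizontal strips by
`LRAll (k+2)`, the two vertical strips by `ikFarRSW_tbCross_all (k+2)`, ONE application of `ApproxHarrisFam` to the
four events at scale `n`) and `RingBlocking`; for `1 ≤ n < n₀` the finite-energy floor `farRSW_small k n₀` at the
trivial far event. -/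
theorem stub_ringOfHarris : RingOfHarris := by
  intro hBl hLR hFam k
  obtain ⟨cL, hcL, hL⟩ := hLR (k + 2)
  obtain ⟨cT, hcT, hT⟩ := ikFarRSW_tbCross_all (k + 2)
  obtain ⟨c, hc, hccL, hccT⟩ : ∃ c : ℝ, 0 < c ∧ c ≤ cL ∧ c ≤ cT :=
    ⟨min cL cT, lt_min hcL hcT, min_le_left _ _, min_le_right _ _⟩
  obtain ⟨n₀, hn₀⟩ := hFam 4 (c ^ 4 / 2) (by positivity)
  obtain ⟨cS, hcS, hS⟩ := farRSW_small k n₀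
  refine ⟨min (c ^ 4 / 2) cS, lt_min (by positivity) hcS, ?_⟩
  intro S n a b w h hn hnw hwk hnh hhk
  haveI := CouplingToLimits.isProbabilityMeasure_μIK
  haveI : IsProbabilityMeasure (νmix S) := isProbabilityMeasure_nuMix S
  rcases Nat.lt_or_ge n n₀ with hlt | hge
  · -- scales `n < n₀`: finite energy at the trivial far event
    have h3 := (hS S n hn hlt a b w h hnw hwk hnh hhk Set.univ MeasurableSet.univ
      (fun _ _ _ => iff_of_true (Set.mem_univ _) (Set.mem_univ _))).2.2
    rw [probReal_univ, mul_one, Set.univ_inter] at h3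
    exact (min_le_right _ _).trans h3
  · -- scales `n ≥ n₀`: the frame and ONE application of approximate Harris
    have hk2 : (k + 2) * n = k * n + 2 * n := by ring
    have hw2 : w + 2 * n ≤ (k + 2) * n := by omega
    have hh2 : h + 2 * n ≤ (k + 2) * n := by omega
    have hn2 : n ≤ (k + 2) * n := by omega
    have hTop : c ≤ pLR S (a - n) (b + h) (w + 2 * n) n := by
      rw [← nuMix_real_lrCross]
      exact hccL.trans (hL S n _ _ _ _ hn (by omega) hw2 le_rfl hn2)
    have hBot : c ≤ pLR S (a - n) (b - n) (w + 2 * n) n := by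
      rw [← nuMix_real_lrCross]
      exact hccL.trans (hL S n _ _ _ _ hn (by omega) hw2 le_rfl hn2)
    have hLeft : c ≤ pTB S (a - n) (b - n) n (h + 2 * n) := by
      rw [← nuMix_real_tbCross]
      exact hccT.trans (hT S n _ _ _ _ hn le_rfl hn2 (by omega) hh2)
    have hRight : c ≤ pTB S (a + w) (b - n) n (h + 2 * n) := by
      rw [← nuMix_real_tbCross]
      exact hccT.trans (hT S n _ _ _ _ hn le_rfl hn2 (by omega) hh2)
    have hfam := frame_family S a b w h n hTop hBot hLeft hRight
    have hHarris := hn₀ S n hge _ (fun i => (hfam i).1)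
    have hprod := pow_le_prod _ hc.le (fun i => (hfam i).2)
    have hsub := measureReal_mono (μ := μIK) (iInter_frame_subset hBl S a b w h n hn)
    have hmap := real_preimage_le_nuMix S (ringEvent a b w h n)
    calc min (c ^ 4 / 2) cS ≤ c ^ 4 / 2 := min_le_left _ _
      _ ≤ (νmix S).real (ringEvent a b w h n) := by linarith

end Summit.CriticalPhenomena.CardyFormulaZ2.Theorems.IKLinearTransport.PinnedDiagramExchange.QuenchedAssembly

end
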